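import Summits.ResolutionOfSingularities.ResolutionOfSingularities.Theorems.EquisingularLiftEquisingularLiftNatVertexLineChartA
import HarnessLib

/-!
# [OURS · L1 W4.5(b) · EL♮(3) · nose residue, D3-9 → D3-9′] The strict transforms of two DIFFERENT lines through the blown-up vertex are DISJOINT

Crux chain w45b, child EL♮(3) = stmt-ResolutionOfSingularities-20148; desk table D3: the input of res-type-027's D3-9′ `dirStepUnobs_union_of_disjoint`
(Steiner's nose `Z′ = L₀′ ⊔ L₁′ ⊔ L₂′` from the three line certificates ✓ `dirStepUnobs_univ_vertexLineStrict`). res-L1-w45b-nose-w3 g2.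
`--supports stmt-ResolutionOfSingularities-20148 --as helper`. OURS; folklore point-set bookkeeping over ✓ `…NatVertexLineChartA`; AI-written.
No `sorry`; standard axioms; DEF-FREE (de Jong kit's `attribute [local instance] MvPolynomial.gradedAlgebra`).

* `disjoint_vertexLineStrict` — for `i ≠ j` the strict transforms `vertexLineStrict b i`, `vertexLineStrict b j` of the lines through the vertex and `e_i`,
  `e_j` are disjoint: off the vertex charts a common point would lie over `D₊(x_l)` with `l = i` and `l = j`; on the vertex chart `Spec C_l` the
  strict transform of the `i`-th line is empty unless `l = i` (✓ `preimage_vertexChart_vertexLineStrict_of_ne`).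

References (index only): R. Hartshorne (1977), II §7 (strict transforms separate at the blown-up point) [cite: Hartshorne1977].
-/

set_option linter.dupNamespace false -- mandated namespace `Summit.<Summit>.<Problem>` of this single-conjunct summit

noncomputable section

open CategoryTheory AlgebraicGeometry TopologicalSpace
open Literature.AlgebraicGeometry.Resolution Literature.AlgebraicGeometry.Resolution.DeJong1996
open Literature.AlgebraicGeometry.Motives.Segre (grading X_mem)

attribute [local instance] MvPolynomial.gradedAlgebra

namespace Summit.ResolutionOfSingularities.ResolutionOfSingularities.Cruxes.EquisingularLiftNat.Sections

variable {d : ℕ} {k : Type} [Field k] {P : Scheme.{0}} {b : P ⟶ Proj (grading (Fin (d + 1 + 1)) k)}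
  (hb : IsBlowup b (vertexIdealSheaf d k))

/-- A point over `D₊(x_l)` on the strict transform of the `i`-th line has `l = i` (the other `x_m` vanish along the line). [folklore] -/
theorem eq_of_mem_vertexLineStrict_of_mem_basicOpen {i l : Fin (d + 1)} {z : P} (hz : z ∈ vertexLineStrict b i)
    (hl : b z ∈ Proj.basicOpen (grading (Fin (d + 1 + 1)) k) (MvPolynomial.X (Fin.castSucc l))) : l = i := by
  by_contra h
  exact (Proj.mem_basicOpen _ _ _).mp hl (vertexLineStrict_subset_preimage b i hz l h)

include hb in
/-- A point of the `l`-th vertex chart on the strict transform of the `i`-th line has `l = i`. [folklore] -/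
theorem eq_of_mem_vertexLineStrict_of_mem_opensRange {i l : Fin (d + 1)} {z : P} (hz : z ∈ vertexLineStrict b i)
    (hl : z ∈ (vertexChart hb l).opensRange) : l = i := by
  by_contra h
  obtain ⟨𝔭, rfl⟩ := hl
  have h𝔭 : 𝔭 ∈ (vertexChart hb l) ⁻¹' vertexLineStrict b i := hz
  rw [preimage_vertexChart_vertexLineStrict_of_ne hb i h] at h𝔭
  exact h𝔭

include hb in
/-- ★ **The strict transforms of two different lines through the blown-up vertex are disjoint.** [cite: Hartshorne1977, II §7]
(OURS computation; folklore) -/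
theorem disjoint_vertexLineStrict {i j : Fin (d + 1)} (hij : i ≠ j) : Disjoint (vertexLineStrict b i) (vertexLineStrict b j) := by
  rw [Set.disjoint_left]
  intro z hzi hzj
  rcases mem_preimage_basicOpen_or_mem_opensRange hb z with ⟨l, hl⟩ | ⟨l, hl⟩
  · exact hij ((eq_of_mem_vertexLineStrict_of_mem_basicOpen hzi hl).symm.trans (eq_of_mem_vertexLineStrict_of_mem_basicOpen hzj hl))
  · exact hij ((eq_of_mem_vertexLineStrict_of_mem_opensRange hb hzi hl).symm.trans (eq_of_mem_vertexLineStrict_of_mem_opensRange hb hzj hl))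

include hb in
/-- The pairwise-disjoint form over an index family (the shape a union lemma consumes). [folklore] -/
theorem pairwise_disjoint_vertexLineStrict : Pairwise fun i j : Fin (d + 1) => Disjoint (vertexLineStrict b i) (vertexLineStrict b j) :=
  fun _ _ hij => disjoint_vertexLineStrict hb hij

end Summit.ResolutionOfSingularities.ResolutionOfSingularities.Cruxes.EquisingularLiftNat.Sections

end
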